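import Literature.NumberTheory.EllipticCurves.AdditiveReductionSemistableModelProofs
import Literature.NumberTheory.EllipticCurves.ModularityVersionAp
import HarnessLib

/-!
# Line `neron_smooth` — the formal-log dichotomy, TYPED AND PROVED at the power-series level
# (crux `ManinLocalTwoThree.ManinPrimeToAdditiveFiveLe`, stmt-BirchSwinnertonDyer-22969; companion
# to `Lines/neron_smooth.lean`, `Lines/neron-smooth.md`, `Lines/neron-smooth-flog.md`)

Seat bsd-idea-19 g2 (planner, lens dual), answering critic idea-crit-15 V#4 (P1) / V#4b (P1′):
«type the formal-log dichotomy over an explicit interface; drop the inseparable branch». This file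
does NOT touch the registered skeleton (`Lines/neron_smooth.lean`, 4 stubs, unchanged) and registers
nothing (W-79); it is sorry-free.

## What is proved (dictionary items D1–D3 of `Lines/neron-smooth-flog.md`, in the tree's language)

The interface is the tree's own formal-group library, not a posited structure. Data: a prime `p`,
a Weierstrass curve `V/ℤ_p` whose reduction has INFINITE HEIGHT, `[p]_{V mod p} = 0`
(`(V.map PadicInt.toZMod).formalMul p = 0` — the additive fibre: `FormalGroupInfiniteHeightProofs`,
`formalMul_eq_zero_of_a_eq_zero_of_charP`; for the crux, `p ≥ 5` additive, this is Step 6 of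
`ManinConstantAdditivePrimesProofs`), a series `ℓ ∈ Xℤ_p⟦X⟧` (for the crux: `ℓ = Σ aₙ(f)Xⁿ/n`,
`p`-integral because `a_{pn} = 0` at an additive prime) and a scalar `u ∈ ℚ_p` (for the crux: the
Manin constant `c`, via `log_W(t∘φ) = c·ℓ`, tree `IsXPresentation.exists_formalLog_subst_eq` /
`ModularParamFormalDictionaryProofs`). The PARAMETRISATION GERM is
`paramGerm V ℓ u := exp_W(u·ℓ)`, `W = V ⊗ ℚ_p` — the `t`-expansion of `φ` at the cusp `∞`.

* `paramGerm_eq_C_mul` — **`exp_W(uℓ) = u · z₁` with `z₁ ∈ Xℤ_p⟦X⟧` and `[X¹]z₁ = [X¹]ℓ`**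
  (for `‖u‖ ≤ 1`): at an additive prime EVERY coefficient of the parametrisation germ is divisible
  by the Manin constant. Input: `exp_W ∈ ℤ_p⟦X⟧` at infinite height
  (`norm_coeff_formalExp_le_one_of_formalMul_prime_eq_zero`, Honda 1970 Thm. 2) — this is (D1)
  «Honda integrality», free at a cusp — and `exp_W = X·E`.
* `norm_coeff_paramGerm_le` — `‖[Xⁿ] exp_W(uℓ)‖ ≤ ‖u‖` for all `n`.
* `coeff_one_paramGerm` — `[X¹] exp_W(uℓ) = u·[X¹]ℓ` (no height hypothesis).
* `int_dvd_iff_forall_norm_coeff_paramGerm_lt_one` — **the two-way dichotomy (D3):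
  `p ∣ c ⟺ exp_W(cℓ) ≡ 0 (mod p)`** (every coefficient of norm `< 1`), for `c ∈ ℤ`, `[X¹]ℓ = 1`;
* `paramGerm_dichotomy` — for `‖u‖ ≤ 1`: EITHER the germ vanishes mod `p` (constant branch) OR its
  linear coefficient is a unit (étale branch). The third, inseparable branch of the g1 card
  (`φ̄|_{C_∞}` non-constant but ramified/inseparable at `∞`) does not exist — as the 324-curve
  computation of `Lines/neron-smooth-flog.md` observed (P2: `ord_∞ ω = 0`, 324/324) and as V#4b (P1′)
  asked to be reflected in the typing.
* (rev 2) `paramGerm_sub_C_mul_eq` — **first-order expansion `exp_W(uℓ) ≡ uℓ (mod u²)`**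
  (`exp_W = X + X²E'`, `E' ∈ ℤ_p⟦X⟧`); `exists_primitiveGerm_congr` — `exp_W(uℓ) = u·z₁` with
  **`z₁ ≡ ℓ (mod u)`** coefficientwise; crux-facing `exists_primitive_paramSeries_congr_lSeriesLog[_of_dvd]`
  — IF `p ∣ c` then the primitive parametrisation series `z₁ = (t∘φ)/c ∈ ℤ_p⟦X⟧` reduces mod `p`
  to `ℓ̄_W = Σ_{p∤n} aₙ n⁻¹ Xⁿ`, i.e. to `θ^{p−2} f̄` — an explicit, computable, LOW-DEGREE rational
  function on the `∞`-component (memo `Lines/neron-smooth-flog2.md`: 324/324 rational, degree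
  median `0.10·deg φ`; the resulting degree certificate `deg(θ^{p−2}f̄) > deg φ ⇒ p ∤ c` is valid but
  dominated by Česnavičius–Neururer–Saha `v_p(c) ≤ v_p(deg φ)`, tree fact
  `cesnaviciusNeururerSaha_padicVal_maninConstant_le_modularDegree`).

## What is NOT proved here (the construction / geometric debts, unchanged)

(G) the identification of `paramGerm` reduced mod `p` with the germ at `∞̄` of the reduction `φ̄`
on the `∞`-component `C_∞` of `X₀(N)_{𝔽_p}` (q-expansion principle on the normalisation of
`X₀(p²M)_{ℤ_(p)}` along `C_∞`; no integral modular curve exists in the tree), under which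
«germ ≡ 0 mod p» ⟺ «`φ̄|_{C_∞}` constant» (`C_∞` is integral); and the line's actual content,
that «`φ̄|_{C_∞}` constant» contradicts the Néron mapping property / the component degree budget
(`stub_caseOne`, `stub_tameSmall` of `Lines/neron_smooth.lean`; law (B) of the flog memo). So this
file turns `p ∣ c` into a VANISHING STATEMENT FOR AN EXPLICIT INTEGRAL q-SERIES and nothing more.
BSD is not proved by any of this; the crux C5 is not proved; no summit statement is touched.

References: T. Honda, J. Math. Soc. Japan 22 (1970) Thm. 2; Osaka J. Math. 5 (1968) Thm. 5 (III)
[corpus: paper:doi-10-18910-8997 p.14–15]; B. Edixhoven, Progr. Math. 89 (1991) Prop. 2 (acq-13151).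
-/

set_option autoImplicit false
set_option linter.dupNamespace false

noncomputable section

open scoped Classical

namespace Summit.BirchSwinnertonDyer.BirchSwinnertonDyer.Cruxes.ManinPrimeToAdditiveFiveLe.NeronSmooth

open PowerSeries Literature.NumberTheory.EllipticCurves

variable {p : ℕ} [hp : Fact p.Prime]

/-- The parametrisation germ `exp_W(u·ℓ)`, `W = V ⊗ ℚ_p` (for the crux: the `t = -x/y`-expansion of
the modular parametrisation at the cusp `∞`, with `u` the Manin constant and `ℓ = Σ aₙXⁿ/n`). -/
def paramGerm (V : WeierstrassCurve ℤ_[p]) (ℓ : ℚ_[p]⟦X⟧) (u : ℚ_[p]) : ℚ_[p]⟦X⟧ :=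
  (V.map PadicInt.Coe.ringHom).formalExp.subst (C u * ℓ)

/-- `[X¹] f(g) = [X¹]f · [X¹]g` for `f(0) = g(0) = 0`. [folklore] -/
theorem coeff_one_subst_eq {K : Type*} [CommRing K] {f g : K⟦X⟧} (hf : constantCoeff f = 0)
    (hg : constantCoeff g = 0) : coeff 1 (f.subst g) = coeff 1 f * coeff 1 g := by
  rw [coeff_subst' (HasSubst.of_constantCoeff_zero' hg), finsum_eq_single _ 1]
  · rw [pow_one, smul_eq_mul]
  · intro d hd
    rcases Nat.lt_or_gt_of_ne hd with h | h
    · have hd0 : d = 0 := by omega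
      subst hd0
      rw [coeff_zero_eq_constantCoeff_apply, hf, zero_smul]
    · have hX : (X : K⟦X⟧) ^ d ∣ g ^ d := pow_dvd_pow_of_dvd (X_dvd_iff.mpr hg) d
      rw [(X_pow_dvd_iff).mp hX 1 (by omega), smul_zero]

/-- `[X¹] exp_W = 1`. [folklore] -/
theorem coeff_one_formalExp (V : WeierstrassCurve ℤ_[p]) :
    coeff 1 (V.map PadicInt.Coe.ringHom).formalExp = 1 := by
  set W := V.map PadicInt.Coe.ringHom
  have h := congrArg (coeff 1) W.formalLog_subst_formalExp
  rwa [coeff_one_subst_eq W.constantCoeff_formalLog W.constantCoeff_formalExp, W.coeff_one_formalLog,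
    one_mul, coeff_one_X] at h

/-- `[X¹] exp_W(u·ℓ) = u · [X¹]ℓ` (no height hypothesis). [folklore] -/
theorem coeff_one_paramGerm (V : WeierstrassCurve ℤ_[p]) {ℓ : ℚ_[p]⟦X⟧} (hℓ0 : constantCoeff ℓ = 0)
    (u : ℚ_[p]) : coeff 1 (paramGerm V ℓ u) = u * coeff 1 ℓ := by
  have ha0 : constantCoeff (C u * ℓ) = 0 := by rw [map_mul, hℓ0, mul_zero]
  rw [paramGerm, coeff_one_subst_eq (V.map PadicInt.Coe.ringHom).constantCoeff_formalExp ha0,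
    coeff_one_formalExp, one_mul, coeff_C_mul]

/-- **At infinite height the parametrisation germ is the Manin constant times a primitive integral
germ: `exp_W(uℓ) = u·z₁`, `z₁ ∈ Xℤ_p⟦X⟧`, `[X¹]z₁ = [X¹]ℓ`** (`‖u‖ ≤ 1`, `ℓ ∈ Xℤ_p⟦X⟧`,
`[p]_{V mod p} = 0`). [cite: Honda1970, Thm. 2 (p. 223)] -/
theorem paramGerm_eq_C_mul (V : WeierstrassCurve ℤ_[p]) (h0 : (V.map PadicInt.toZMod).formalMul p = 0)
    {ℓ : ℚ_[p]⟦X⟧} (hℓ0 : constantCoeff ℓ = 0) (hℓ : IsPadicInt ℓ) {u : ℚ_[p]} (hu : ‖u‖ ≤ 1) :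
    ∃ z₁ : ℚ_[p]⟦X⟧, IsPadicInt z₁ ∧ constantCoeff z₁ = 0 ∧ coeff 1 z₁ = coeff 1 ℓ ∧
      paramGerm V ℓ u = C u * z₁ := by
  set W := V.map PadicInt.Coe.ringHom with hW
  obtain ⟨E, hE⟩ := (X_dvd_iff (φ := W.formalExp)).mpr W.constantCoeff_formalExp
  have hEcoeff : ∀ n, coeff n E = coeff (n + 1) W.formalExp := fun n ↦ by
    rw [hE, coeff_succ_X_mul]
  have hEI : IsPadicInt E := isPadicInt_iff_coeff.mpr fun n ↦ by
    rw [hEcoeff]; exact V.norm_coeff_formalExp_le_one_of_formalMul_prime_eq_zero h0 (n + 1)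
  have hE0 : constantCoeff E = 1 := by
    rw [← coeff_zero_eq_constantCoeff_apply, hEcoeff, zero_add]
    exact coeff_one_formalExp V
  set a : ℚ_[p]⟦X⟧ := C u * ℓ with ha
  have ha0 : constantCoeff a = 0 := by rw [ha, map_mul, hℓ0, mul_zero]
  have has : HasSubst a := HasSubst.of_constantCoeff_zero' ha0
  have hCI : IsPadicInt (C u : ℚ_[p]⟦X⟧) := IsPadicInt.C hu
  have haI : IsPadicInt a := IsPadicInt.mul hCI hℓ
  have hG0 : constantCoeff (E.subst a) = 1 := by
    rw [constantCoeff_subst_of_constantCoeff_eq_zero ha0, hE0]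
  refine ⟨ℓ * E.subst a, IsPadicInt.mul hℓ (hEI.powerSeries_subst haI has), ?_, ?_, ?_⟩
  · rw [map_mul, hℓ0, zero_mul]
  · rw [coeff_mul, Finset.Nat.sum_antidiagonal_succ, Finset.Nat.antidiagonal_zero,
      Finset.sum_singleton]
    simp only [zero_add]
    rw [coeff_zero_eq_constantCoeff_apply, hℓ0, zero_mul, zero_add, coeff_zero_eq_constantCoeff_apply,
      hG0, mul_one]
  · show W.formalExp.subst a = C u * (ℓ * E.subst a)
    rw [hE, subst_mul has, subst_X has, mul_assoc]

/-- **`‖[Xⁿ] exp_W(uℓ)‖ ≤ ‖u‖`**: every coefficient of the germ is divisible by the Manin constant.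
[cite: Honda1970, Thm. 2 (p. 223)] -/
theorem norm_coeff_paramGerm_le (V : WeierstrassCurve ℤ_[p])
    (h0 : (V.map PadicInt.toZMod).formalMul p = 0) {ℓ : ℚ_[p]⟦X⟧} (hℓ0 : constantCoeff ℓ = 0)
    (hℓ : IsPadicInt ℓ) {u : ℚ_[p]} (hu : ‖u‖ ≤ 1) (n : ℕ) :
    ‖coeff n (paramGerm V ℓ u)‖ ≤ ‖u‖ := by
  obtain ⟨z₁, hz₁, -, -, hz⟩ := paramGerm_eq_C_mul V h0 hℓ0 hℓ hu
  rw [hz, coeff_C_mul, norm_mul]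
  exact mul_le_of_le_one_right (norm_nonneg u) (isPadicInt_iff_coeff.mp hz₁ n)

/-- **First-order expansion at infinite height: `exp_W(uℓ) ≡ uℓ (mod u²)`.** Writing
`exp_W = X + X²·E'` with `E' ∈ ℤ_p⟦X⟧` (infinite height), `exp_W(uℓ) − uℓ = u²·(ℓ²·E'(uℓ))` with
`ℓ² E'(uℓ) ∈ ℤ_p⟦X⟧`: to first order in `u` the formal group is additive. [cite: Honda1970, Thm. 2 (p. 223)] -/
theorem paramGerm_sub_C_mul_eq (V : WeierstrassCurve ℤ_[p])
    (h0 : (V.map PadicInt.toZMod).formalMul p = 0) {ℓ : ℚ_[p]⟦X⟧} (hℓ0 : constantCoeff ℓ = 0)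
    (hℓ : IsPadicInt ℓ) {u : ℚ_[p]} (hu : ‖u‖ ≤ 1) :
    ∃ z₂ : ℚ_[p]⟦X⟧, IsPadicInt z₂ ∧ paramGerm V ℓ u - C u * ℓ = C (u * u) * z₂ := by
  set W := V.map PadicInt.Coe.ringHom with hW
  obtain ⟨E, hE⟩ := (X_dvd_iff (φ := W.formalExp)).mpr W.constantCoeff_formalExp
  have hEcoeff : ∀ n, coeff n E = coeff (n + 1) W.formalExp := fun n ↦ by
    rw [hE, coeff_succ_X_mul]
  have hEI : IsPadicInt E := isPadicInt_iff_coeff.mpr fun n ↦ by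
    rw [hEcoeff]; exact V.norm_coeff_formalExp_le_one_of_formalMul_prime_eq_zero h0 (n + 1)
  have hE0 : constantCoeff E = 1 := by
    rw [← coeff_zero_eq_constantCoeff_apply, hEcoeff, zero_add]
    exact coeff_one_formalExp V
  obtain ⟨E', hE'⟩ := (X_dvd_iff (φ := E - 1)).mpr (by rw [map_sub, hE0, map_one, sub_self])
  have hE'I : IsPadicInt E' := isPadicInt_iff_coeff.mpr fun n ↦ by
    have h := congrArg (coeff (n + 1)) hE'
    rw [coeff_succ_X_mul, map_sub, coeff_one, if_neg (Nat.succ_ne_zero n), sub_zero] at h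
    rw [← h]; exact isPadicInt_iff_coeff.mp hEI (n + 1)
  set a : ℚ_[p]⟦X⟧ := C u * ℓ with ha
  have ha0 : constantCoeff a = 0 := by rw [ha, map_mul, hℓ0, mul_zero]
  have has : HasSubst a := HasSubst.of_constantCoeff_zero' ha0
  have haI : IsPadicInt a := IsPadicInt.mul (IsPadicInt.C hu) hℓ
  have h1 : (1 : ℚ_[p]⟦X⟧).subst a = 1 := by rw [← coe_substAlgHom has]; exact map_one _
  have hEeq : E = 1 + X * E' := by rw [← hE']; ring
  refine ⟨ℓ * ℓ * E'.subst a, IsPadicInt.mul (IsPadicInt.mul hℓ hℓ) (hE'I.powerSeries_subst haI has),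
    ?_⟩
  show W.formalExp.subst a - C u * ℓ = C (u * u) * (ℓ * ℓ * E'.subst a)
  rw [hE, subst_mul has, subst_X has, hEeq, subst_add has, h1, subst_mul has, subst_X has, ha,
    map_mul]
  ring

/-- **The primitive germ is congruent to `ℓ` modulo `u`**: `exp_W(uℓ) = u·z₁` with `z₁ ∈ ℤ_p⟦X⟧` and
`z₁ ≡ ℓ (mod u)` coefficientwise. For the crux (`u = c`, `p ∣ c`): IF `p` divided the Manin constant,
the primitive parametrisation series `(t∘φ)/c` would reduce mod `p` to the formal logarithm series
`ℓ̄_W = Σ_{p∤n} aₙ n⁻¹ qⁿ = θ^{p−2} f̄` itself. [cite: Honda1970, Thm. 2 (p. 223)] -/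
theorem exists_primitiveGerm_congr (V : WeierstrassCurve ℤ_[p])
    (h0 : (V.map PadicInt.toZMod).formalMul p = 0) {ℓ : ℚ_[p]⟦X⟧} (hℓ0 : constantCoeff ℓ = 0)
    (hℓ : IsPadicInt ℓ) {u : ℚ_[p]} (hu : ‖u‖ ≤ 1) :
    ∃ z₁ : ℚ_[p]⟦X⟧, IsPadicInt z₁ ∧ paramGerm V ℓ u = C u * z₁ ∧
      ∀ n, ‖coeff n (z₁ - ℓ)‖ ≤ ‖u‖ := by
  obtain ⟨z₂, hz₂, h⟩ := paramGerm_sub_C_mul_eq V h0 hℓ0 hℓ hu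
  refine ⟨ℓ + C u * z₂, IsPadicInt.add hℓ (IsPadicInt.mul (IsPadicInt.C hu) hz₂), ?_, fun n ↦ ?_⟩
  · rw [mul_add, ← mul_assoc, ← map_mul, ← h]; ring
  · rw [add_sub_cancel_left, coeff_C_mul, norm_mul]
    exact mul_le_of_le_one_right (norm_nonneg u) (isPadicInt_iff_coeff.mp hz₂ n)

/-- **The dichotomy (D3), no third branch**: for `‖u‖ ≤ 1`, either the germ vanishes mod `p`
(`φ̄|_{C_∞}` constant) or its linear coefficient is a unit (`φ̄|_{C_∞}` étale at `∞`).
[cite: Honda1970, Thm. 2 (p. 223)] -/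
theorem paramGerm_dichotomy (V : WeierstrassCurve ℤ_[p])
    (h0 : (V.map PadicInt.toZMod).formalMul p = 0) {ℓ : ℚ_[p]⟦X⟧} (hℓ0 : constantCoeff ℓ = 0)
    (hℓ : IsPadicInt ℓ) (hℓ1 : coeff 1 ℓ = 1) {u : ℚ_[p]} (hu : ‖u‖ ≤ 1) :
    (∀ n, ‖coeff n (paramGerm V ℓ u)‖ < 1) ∨ ‖coeff 1 (paramGerm V ℓ u)‖ = 1 := by
  rcases hu.lt_or_eq with hlt | heq
  · exact Or.inl fun n ↦ lt_of_le_of_lt (norm_coeff_paramGerm_le V h0 hℓ0 hℓ hu n) hlt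
  · refine Or.inr ?_
    rw [coeff_one_paramGerm V hℓ0, hℓ1, mul_one, heq]

/-- **`p ∣ c ⟺ exp_W(cℓ) ≡ 0 (mod p)`** for an integer `c` (the Manin constant) — the typed
two-way form of «`p ∣ c` iff `φ̄` contracts `C_∞`» at the level of the germ.
[cite: Honda1970, Thm. 2 (p. 223)] -/
theorem int_dvd_iff_forall_norm_coeff_paramGerm_lt_one (V : WeierstrassCurve ℤ_[p])
    (h0 : (V.map PadicInt.toZMod).formalMul p = 0) {ℓ : ℚ_[p]⟦X⟧} (hℓ0 : constantCoeff ℓ = 0)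
    (hℓ : IsPadicInt ℓ) (hℓ1 : coeff 1 ℓ = 1) (c : ℤ) :
    (p : ℤ) ∣ c ↔ ∀ n, ‖coeff n (paramGerm V ℓ (c : ℚ_[p]))‖ < 1 := by
  have hc1 : ‖((c : ℤ_[p]) : ℚ_[p])‖ ≤ 1 := PadicInt.norm_le_one _
  have hcc : ((c : ℤ_[p]) : ℚ_[p]) = (c : ℚ_[p]) := by simp
  rw [hcc] at hc1
  constructor
  · intro hdvd n
    have hlt : ‖(c : ℚ_[p])‖ < 1 := by
      rw [← hcc]; exact PadicInt.norm_int_lt_one_iff_dvd c |>.mpr hdvd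
    exact lt_of_le_of_lt (norm_coeff_paramGerm_le V h0 hℓ0 hℓ hc1 n) hlt
  · intro h
    have h1 := h 1
    rw [coeff_one_paramGerm V hℓ0, hℓ1, mul_one, ← hcc] at h1
    exact (PadicInt.norm_int_lt_one_iff_dvd c).mp h1

/-! ### Instantiation for the crux: `W/ℚ` globally minimal, `p ≥ 5` additive -/

section Crux

open WeierstrassCurve Literature.NumberTheory.EllipticCurves.ModularForms

/-- The `L`-series logarithm `ℓ_W = Σ aₙ(W) Xⁿ/n ∈ ℚ_p⟦X⟧` (the shape used in
`AdditiveReductionSemistableModelProofs.norm_coeff_lSeriesLog_le_one_of_dvd_of_dvd`). -/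
def lSeriesLog (W : WeierstrassCurve ℚ) (p : ℕ) [Fact p.Prime] : ℚ_[p]⟦X⟧ :=
  PowerSeries.mk fun k ↦ ((W.LFunction k : ℤ) : ℚ_[p]) / k

theorem constantCoeff_lSeriesLog (W : WeierstrassCurve ℚ) : constantCoeff (lSeriesLog W p) = 0 := by
  rw [← coeff_zero_eq_constantCoeff_apply, lSeriesLog, coeff_mk, Nat.cast_zero, div_zero]

theorem coeff_one_lSeriesLog (W : WeierstrassCurve ℚ) : coeff 1 (lSeriesLog W p) = 1 := by
  rw [lSeriesLog, coeff_mk, W.isMultiplicative_LFunction.map_one, Int.cast_one, Nat.cast_one, div_one]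

/-- `ℓ_W ∈ ℤ_p⟦X⟧` at an additive prime (`aₙ = 0` for `p ∣ n`) — dictionary item (D1′).
[cite: SilvermanAEC2009, §C.16] -/
theorem isPadicInt_lSeriesLog_of_dvd_of_dvd (W : WeierstrassCurve ℚ) [W.IsElliptic]
    [W.IsGloballyMinimal] (hΔ : (p : ℤ) ∣ minimalDiscriminantInt W)
    (hc₄ : (p : ℤ) ∣ (integralModelInt W).c₄) : IsPadicInt (lSeriesLog W p) :=
  isPadicInt_iff_coeff.mpr (W.norm_coeff_lSeriesLog_le_one_of_dvd_of_dvd p hΔ hc₄)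

/-- The germ is characterised by its logarithm: if `log_W(z₀) = u·ℓ` and `z₀(0) = 0` then
`z₀ = exp_W(u·ℓ) = paramGerm V ℓ u` (this is the shape `log_{E₀}(z₀) = u ℓ` in which the tree states
the modular parametrisation, `ManinConstantAdditivePrimesProofs` Step 6). [folklore] -/
theorem paramGerm_eq_of_formalLog_subst_eq (V : WeierstrassCurve ℤ_[p]) {ℓ z₀ : ℚ_[p]⟦X⟧}
    {u : ℚ_[p]} (hz0 : constantCoeff z₀ = 0)
    (h : (V.map PadicInt.Coe.ringHom).formalLog.subst z₀ = C u * ℓ) : paramGerm V ℓ u = z₀ := by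
  set W := V.map PadicInt.Coe.ringHom with hW
  have hb : HasSubst z₀ := HasSubst.of_constantCoeff_zero' hz0
  have ha : HasSubst W.formalLog := HasSubst.of_constantCoeff_zero' W.constantCoeff_formalLog
  show W.formalExp.subst (C u * ℓ) = z₀
  rw [← h, ← subst_comp_subst_apply ha hb, W.formalExp_subst_formalLog, subst_X hb]

/-- **The crux-facing dichotomy.** `W/ℚ` globally minimal elliptic; `p ≥ 5` a prime of ADDITIVE
reduction (`p ∣ Δ_min(W)`, `p ∣ c₄(W)` — for the crux C5: `p² ∣ N`); `V₀/ℤ_p` a `p`-integral short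
model with additive reduction (`‖c₄‖ < 1`, `‖Δ‖ < 1`; for the crux: the short model of `W ⊗ ℚ_p`,
Steps 1–5 of `ManinConstantGoodPrimesProofs`); `z₀ ∈ Xℚ_p⟦X⟧` with `log_{V₀}(z₀) = c · ℓ_W` (for
the crux: the modular parametrisation in the parameter `t = -x/y` of `V₀`, `c` the Manin constant —
tree `IsXPresentation.exists_formalLog_subst_eq` / `ModularParamFormalDictionaryProofs`). THEN
`p ∣ c ⟺ z₀ ≡ 0 (mod p)` (every coefficient of norm `< 1`). What remains for C5 is geometric debt
(G) of the module docstring: `z₀ ≢ 0 (mod p)`, i.e. `φ̄` does not contract `C_∞`.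
[cite: Honda1970, Thm. 2 (p. 223)] -/
theorem int_dvd_iff_paramSeries_vanishes (hp5 : 5 ≤ p) (W : WeierstrassCurve ℚ) [W.IsElliptic]
    [W.IsGloballyMinimal] (hΔ : (p : ℤ) ∣ minimalDiscriminantInt W)
    (hc₄ : (p : ℤ) ∣ (integralModelInt W).c₄) (V₀ : WeierstrassCurve ℤ_[p])
    [(V₀.map PadicInt.Coe.ringHom).IsShortNF] (hV₀c₄ : ‖(V₀.map PadicInt.Coe.ringHom).c₄‖ < 1)
    (hV₀Δ : ‖(V₀.map PadicInt.Coe.ringHom).Δ‖ < 1) (c : ℤ) {z₀ : ℚ_[p]⟦X⟧}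
    (hz0 : constantCoeff z₀ = 0)
    (hlog : (V₀.map PadicInt.Coe.ringHom).formalLog.subst z₀ = C (c : ℚ_[p]) * lSeriesLog W p) :
    (p : ℤ) ∣ c ↔ ∀ n, ‖coeff n z₀‖ < 1 := by
  have h0 := formalMul_prime_map_toZMod_eq_zero_of_isShortNF hp5 V₀ hV₀c₄ hV₀Δ
  rw [← paramGerm_eq_of_formalLog_subst_eq V₀ hz0 hlog]
  exact int_dvd_iff_forall_norm_coeff_paramGerm_lt_one V₀ h0 (constantCoeff_lSeriesLog W)
    (isPadicInt_lSeriesLog_of_dvd_of_dvd W hΔ hc₄) (coeff_one_lSeriesLog W) c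

/-- **…and its contrapositive half as the line needs it**: `p ∤ c` as soon as ONE coefficient of the
parametrisation series is a `p`-adic unit (equivalently, by `paramGerm_dichotomy`, as soon as the
series is non-zero mod `p`, in which case already `[X¹]z₀ = c` is a unit). [cite: Honda1970, Thm. 2 (p. 223)] -/
theorem not_int_dvd_of_exists_norm_coeff_eq_one (hp5 : 5 ≤ p) (W : WeierstrassCurve ℚ)
    [W.IsElliptic] [W.IsGloballyMinimal] (hΔ : (p : ℤ) ∣ minimalDiscriminantInt W)
    (hc₄ : (p : ℤ) ∣ (integralModelInt W).c₄) (V₀ : WeierstrassCurve ℤ_[p])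
    [(V₀.map PadicInt.Coe.ringHom).IsShortNF] (hV₀c₄ : ‖(V₀.map PadicInt.Coe.ringHom).c₄‖ < 1)
    (hV₀Δ : ‖(V₀.map PadicInt.Coe.ringHom).Δ‖ < 1) (c : ℤ) {z₀ : ℚ_[p]⟦X⟧}
    (hz0 : constantCoeff z₀ = 0)
    (hlog : (V₀.map PadicInt.Coe.ringHom).formalLog.subst z₀ = C (c : ℚ_[p]) * lSeriesLog W p)
    (hunit : ∃ n, ‖coeff n z₀‖ = 1) : ¬ (p : ℤ) ∣ c := by
  intro hdvd
  obtain ⟨n, hn⟩ := hunit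
  have h := (int_dvd_iff_paramSeries_vanishes hp5 W hΔ hc₄ V₀ hV₀c₄ hV₀Δ c hz0 hlog).mp hdvd n
  rw [hn] at h
  exact lt_irrefl _ h

/-- **What `p ∣ c` would force, by name.** Same hypotheses; then `z₀ = c · z₁` with `z₁ ∈ ℤ_p⟦X⟧`
and `z₁ ≡ ℓ_W (mod c)` coefficientwise — so if `p ∣ c`, the primitive parametrisation series
`z₁ = (t∘φ)/c` reduces mod `p` to `ℓ̄_W = Σ_{p∤n} aₙ(W) n⁻¹ Xⁿ`, the `θ^{p-2}`-image of `f̄`, an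
explicitly computable low-degree rational function on the `∞`-component `X₀(N/p²)_{𝔽_p}` (memo
`Lines/neron-smooth-flog2.md`: degree `≤ deg φ` would follow; dominated by Česnavičius–Neururer–Saha).
[cite: Honda1970, Thm. 2 (p. 223)] -/
theorem exists_primitive_paramSeries_congr_lSeriesLog (hp5 : 5 ≤ p) (W : WeierstrassCurve ℚ)
    [W.IsElliptic] [W.IsGloballyMinimal] (hΔ : (p : ℤ) ∣ minimalDiscriminantInt W)
    (hc₄ : (p : ℤ) ∣ (integralModelInt W).c₄) (V₀ : WeierstrassCurve ℤ_[p])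
    [(V₀.map PadicInt.Coe.ringHom).IsShortNF] (hV₀c₄ : ‖(V₀.map PadicInt.Coe.ringHom).c₄‖ < 1)
    (hV₀Δ : ‖(V₀.map PadicInt.Coe.ringHom).Δ‖ < 1) (c : ℤ) {z₀ : ℚ_[p]⟦X⟧}
    (hz0 : constantCoeff z₀ = 0)
    (hlog : (V₀.map PadicInt.Coe.ringHom).formalLog.subst z₀ = C (c : ℚ_[p]) * lSeriesLog W p) :
    ∃ z₁ : ℚ_[p]⟦X⟧, IsPadicInt z₁ ∧ z₀ = C (c : ℚ_[p]) * z₁ ∧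
      ∀ n, ‖coeff n (z₁ - lSeriesLog W p)‖ ≤ ‖(c : ℚ_[p])‖ := by
  have h0 := formalMul_prime_map_toZMod_eq_zero_of_isShortNF hp5 V₀ hV₀c₄ hV₀Δ
  have hc1 : ‖((c : ℤ_[p]) : ℚ_[p])‖ ≤ 1 := PadicInt.norm_le_one _
  have hcc : ((c : ℤ_[p]) : ℚ_[p]) = (c : ℚ_[p]) := by simp
  rw [hcc] at hc1
  rw [← paramGerm_eq_of_formalLog_subst_eq V₀ hz0 hlog]
  exact exists_primitiveGerm_congr V₀ h0 (constantCoeff_lSeriesLog W)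
    (isPadicInt_lSeriesLog_of_dvd_of_dvd W hΔ hc₄) hc1

/-- **`p ∣ c ⟹ (t∘φ)/c ≡ ℓ_W (mod p)`**, the form used in the memo. [cite: Honda1970, Thm. 2 (p. 223)] -/
theorem exists_primitive_paramSeries_congr_lSeriesLog_of_dvd (hp5 : 5 ≤ p) (W : WeierstrassCurve ℚ)
    [W.IsElliptic] [W.IsGloballyMinimal] (hΔ : (p : ℤ) ∣ minimalDiscriminantInt W)
    (hc₄ : (p : ℤ) ∣ (integralModelInt W).c₄) (V₀ : WeierstrassCurve ℤ_[p])
    [(V₀.map PadicInt.Coe.ringHom).IsShortNF] (hV₀c₄ : ‖(V₀.map PadicInt.Coe.ringHom).c₄‖ < 1)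
    (hV₀Δ : ‖(V₀.map PadicInt.Coe.ringHom).Δ‖ < 1) {c : ℤ} (hpc : (p : ℤ) ∣ c) {z₀ : ℚ_[p]⟦X⟧}
    (hz0 : constantCoeff z₀ = 0)
    (hlog : (V₀.map PadicInt.Coe.ringHom).formalLog.subst z₀ = C (c : ℚ_[p]) * lSeriesLog W p) :
    ∃ z₁ : ℚ_[p]⟦X⟧, IsPadicInt z₁ ∧ z₀ = C (c : ℚ_[p]) * z₁ ∧
      ∀ n, ‖coeff n (z₁ - lSeriesLog W p)‖ < 1 := by
  obtain ⟨z₁, hz₁, hz, hcong⟩ :=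
    exists_primitive_paramSeries_congr_lSeriesLog hp5 W hΔ hc₄ V₀ hV₀c₄ hV₀Δ c hz0 hlog
  have hlt : ‖(c : ℚ_[p])‖ < 1 := by
    have hcc : ((c : ℤ_[p]) : ℚ_[p]) = (c : ℚ_[p]) := by simp
    rw [← hcc]; exact PadicInt.norm_int_lt_one_iff_dvd c |>.mpr hpc
  exact ⟨z₁, hz₁, hz, fun n ↦ lt_of_le_of_lt (hcong n) hlt⟩

end Crux

end Summit.BirchSwinnertonDyer.BirchSwinnertonDyer.Cruxes.ManinPrimeToAdditiveFiveLe.NeronSmooth
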